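import Summits.ResolutionOfSingularities.ResolutionOfSingularities.Theorems.PurelyInseparableDim4ResConeWeightLedgerLossMonitor
import HarnessLib
import HarnessLib.Audit.Tags

/-!
# Purely inseparable four-folds — THE WEIGHT LEDGER WITH THE EFFECTIVE MONITOR: translating a WEIGHTLESS letter is not a hit
# (cell `res-dim4-pi`, K2(p) lane, rows B-LOSSY in the T-sector; seat res-dim4-p-8 g7, over g6's FILEs 1–3 and 5)

[OURS · counted 0 · cell `res-dim4-pi` · K2(p) lane (holder res-dim4-p-12 g5: «(7, d, 3) LOSSY certificates vs my tsector7 rows = K-twin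
wanted», rulings g5-21) · seat res-dim4-p-8 g7.]  **HONEST LABEL.**  Bookkeeping about OUR frame: these theorems refine the frozen-set
monitor of `…WeightLedgerPermanence` so that res-dim4-p-1's T-SECTOR NORMAL FORM (`powerCone_freeCarrier_representation`, p715478: the
form-carrying letter `φ` has weight `0` and is never CHARTED — but may be TRANSLATED) is read by the certificates.  They kill nothing by
themselves.  Nothing here proves any TAIL(p, d, e), K2(7), K2(p), `NoIsolatedTrap p p`, CJS 6.40 or resolution of singularities in
dimension ≥ 4 / characteristic `p` — NOT proved.  AI kernel work, weaker than expert review.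

THE POINT.  The g6 monitor (`exists_frozen_monitor j b`) calls a letter FROZEN when it is eventually never charted AND never translated
(`b k z = 0`).  A weightless letter that is translated changes nothing in the ledger (`child` forgets the kept-flag of a weight-`0` letter), so
the EFFECTIVE translation record `b⁺ k z := if r_k z = 0 then 0 else b k z` drives the same ledger walk (`tail_ledger_child_eff`), and the
monitor run on `(j, b⁺)` freezes every never-charted weightless letter — in particular the T-sector carrier `φ`.
* §1 `child_congr_of_flags`, `tail_ledger_child_eff` — the ledger child only reads the kept-flags of weighted letters.
* §2 **`frozen_confinement_core_eff`** — `frozen_confinement_core` verbatim for the effective monitor: frozen letters are never charted and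
  never LOST (`b k z = 0 ∨ r_k z = 0`), the other letters are charted or lost beyond every index; verdicts `1` (dock), `2` (FT), `4` (res-dim4-p-5's
  `no_tail_of_permanent_weight_ge`, applied to the WEIGHTED frozen letters) and `5 + w` (fairness) excluded, `3` ⇒ no late lossy edge.
* §3 **`tail_confined_of_ledgerCheckPerm_lossy_eff`** (lossy branch, any `e_G`) and **`tail_lossy_confined_freeLetter`**: a lossy tail with a
  letter `φ` that is weightless and uncharted from `k₀` on is confined to a LIVE level of the certificate at a frozen set `P ∋ φ` — so the
  «frozen weight `0`» residues of the `(7, d, 3)` LOSSY certificates (res-dim4-p-8 g6, p718538/59/63/69) ARE the T-sector B-LOSSY rows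
  (res-dim4-p-12 g5's `tsector7` list, bus 2026-08-29 l.6609; K-twin `blf.py` l.6612), as a kernel class binder (`…WeightLedgerSevenTSectorLossy`).
[cite: CossartJannsenSaito2020, Thm. 3.14] bears_on: LADDER-RESOLUTION:D157-DOOR2 (res-dim4-pi · K2(p) · weight ledger, effective monitor,
T-sector B-LOSSY rows).  Supports stmt-ResolutionOfSingularities-16155 (helper).
-/

set_option linter.dupNamespace false -- mandated namespace of this single-conjunct summit

noncomputable section

namespace Summit.ResolutionOfSingularities.ResolutionOfSingularities.Theorems.PIDim4

namespace ResCone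

open MvPolynomial Finset Literature.AlgebraicGeometry.Resolution
open Literature.AlgebraicGeometry.Resolution.CentreBlowup Literature.AlgebraicGeometry.Resolution.Hauser2010
open WeightLedger

namespace WeightLedger

/-! ## 1. The ledger child only reads the kept-flags of weighted letters -/

/-- Two kept-flag vectors that agree on the WEIGHTED letters give the same ledger child. [folklore] -/
theorem child_congr_of_flags {p d : ℕ} {a : Fin 4 → ℕ} {jj : Fin 4} {S S' : Fin 4 → Bool}
    (h : ∀ i, a i ≠ 0 → S i = S' i) : child p d a jj S = child p d a jj S' := by
  funext i
  by_cases hij : i = jj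
  · subst hij; rw [child_apply_self, child_apply_self]
  · rw [child_apply_of_ne _ hij, child_apply_of_ne _ hij]
    by_cases hai : a i = 0
    · simp [hai]
    · rw [h i hai]

end WeightLedger

section Chain

variable {K : Type} [Field K] (p : ℕ) [Fact p.Prime] [CharP K p] [DecidableEq K]
  {c : ℕ → State K} {j : ℕ → Fin 4} {b : ℕ → Fin 4 → K}

omit [CharP K p] in
/-- **THE CHAIN STEPS ALONG LEDGER EDGES, EFFECTIVE FLAGS**: for `k ≥ k₀`, `⇑r_{k+1}` is the ledger child of `⇑r_k` by the chart `j k` with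
kept flags «`b⁺ k i = 0`», `b⁺ k i := if r_k i = 0 then 0 else b k i` (a weightless letter counts as kept whatever its translation).
[OURS · bookkeeping] -/
theorem tail_ledger_child_eff
    (hc : ∀ k, IsIsolated p (c k).F ∧ Step0 p (c k) (c (k + 1))) (hw : FreeTail.IsWitnessedChain p c j b)
    (hr0 : ∀ e ∈ (c 0).F.support, (c 0).r ≤ e) (hfloor : ∀ k, ordZero (c k).F ≠ p) {k₀ d : ℕ}
    (hshade : ∀ k, k₀ ≤ k → (c k).shade = (d : ℕ∞)) {k : ℕ} (hk : k₀ ≤ k) :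
    ⇑(c (k + 1)).r = child p d ⇑(c k).r (j k)
      (fun i => decide ((if (c k).r i = 0 then (0 : K) else b k i) = 0)) := by
  rw [tail_ledger_child p hc hw hr0 hfloor hshade hk]
  exact child_congr_of_flags fun i hi => by simp [hi]

/-! ## 2. The frozen-set confinement core with the effective monitor -/

/-- **THE FROZEN-SET CONFINEMENT CORE, EFFECTIVE MONITOR** (every prime `p`, every shade `d`, any `e_G`): as `frozen_confinement_core`, but
the frozen set `P` consists of the letters eventually never charted and never LOST (`b k z = 0 ∨ r_k z = 0`), and every other letter is
charted or lost (`b k z ≠ 0 ∧ r_k z ≠ 0`) beyond every index.  Same certificate, same admissibility shape (stated for the effective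
record). [OURS] [cite: CossartJannsenSaito2020, Thm. 3.14] -/
theorem frozen_confinement_core_eff
    (hc : ∀ k, IsIsolated p (c k).F ∧ Step0 p (c k) (c (k + 1))) (hw : FreeTail.IsWitnessedChain p c j b)
    (hr0 : ∀ e ∈ (c 0).F.support, (c 0).r ≤ e) (hfloor : ∀ k, ordZero (c k).F ≠ p) {k₀ d : ℕ}
    (hshade : ∀ k, k₀ ≤ k → (c k).shade = (d : ℕ∞))
    {ok : (Fin 4 → Bool) → (Fin 4 → ℕ) → Bool} {h : (Fin 4 → Bool) → (Fin 4 → ℕ) → ℕ} {v : ℕ → ℕ}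
    (H : ∀ P, ledgerCheckPermAt p d ok h v P = true)
    (hok : ∀ (P : Fin 4 → Bool) (k₁ : ℕ), k₀ ≤ k₁ →
      (∀ k, k₁ ≤ k → ∀ z, P z = true → j k ≠ z ∧ (b k z = 0 ∨ (c k).r z = 0)) →
      (∀ z, P z = false → ∀ k₂, ∃ k, k₂ ≤ k ∧ (j k = z ∨ (b k z ≠ 0 ∧ (c k).r z ≠ 0))) →
      ∃ k₂, k₁ ≤ k₂ ∧ ∀ k, k₂ ≤ k → ok P ⇑(c k).r = true) :
    ∃ (P : Fin 4 → Bool) (i k₂ : ℕ), k₀ ≤ k₂ ∧ (∀ k, k₂ ≤ k → Legal p d ⇑(c k).r ∧ ok P ⇑(c k).r = true ∧ h P ⇑(c k).r = i) ∧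
      (∀ k, k₂ ≤ k → ∀ z, P z = true → j k ≠ z ∧ (b k z = 0 ∨ (c k).r z = 0)) ∧
      (∀ z, P z = false → ∀ k₃, ∃ k, k₃ ≤ k ∧ (j k = z ∨ (b k z ≠ 0 ∧ (c k).r z ≠ 0))) ∧
      v i ≤ p + 3 ∧ v i ≠ 1 ∧ v i ≠ 2 ∧ v i ≠ 4 ∧ ¬ 5 ≤ v i ∧
      (v i = 3 → ∀ k, k₂ ≤ k → ¬ Lossy ⇑(c k).r ⇑(c (k + 1)).r) := by
  classical
  -- the effective translation record
  set β : ℕ → Fin 4 → K := fun k i => if (c k).r i = 0 then 0 else b k i with hβ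
  have hβ0 : ∀ k z, β k z = 0 ↔ (b k z = 0 ∨ (c k).r z = 0) := fun k z => by
    simp only [hβ]; split_ifs with h0 <;> simp [h0]
  have hβ1 : ∀ k z, β k z ≠ 0 ↔ (b k z ≠ 0 ∧ (c k).r z ≠ 0) := fun k z => by
    rw [Ne, hβ0]; tauto
  obtain ⟨P, k₁, hk₁, hfrozenβ, hhitβ⟩ := exists_frozen_monitor j β k₀
  have hfrozen : ∀ k, k₁ ≤ k → ∀ z, P z = true → j k ≠ z ∧ (b k z = 0 ∨ (c k).r z = 0) :=
    fun k hk z hz => ⟨(hfrozenβ k hk z hz).1, (hβ0 k z).mp (hfrozenβ k hk z hz).2⟩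
  have hhit : ∀ z, P z = false → ∀ k₂, ∃ k, k₂ ≤ k ∧ (j k = z ∨ (b k z ≠ 0 ∧ (c k).r z ≠ 0)) := by
    intro z hz k₂
    obtain ⟨k, hk, hjk⟩ := hhitβ z hz k₂
    exact ⟨k, hk, hjk.imp id (hβ1 k z).mp⟩
  obtain ⟨k₂, hk₂, hokk⟩ := hok P k₁ hk₁ hfrozen hhit
  -- the walk's effective edges keep `P` from `k₁`
  have hkeeps : ∀ k, k₁ ≤ k → keepsB P (j k) (fun i => decide (β k i = 0)) = true := by
    intro k hk
    rw [keepsB_eq_true_iff]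
    refine ⟨?_, fun z hz => decide_eq_true (hfrozenβ k hk z hz).2⟩
    by_contra hPj
    rw [Bool.not_eq_false] at hPj
    exact (hfrozenβ k hk (j k) hPj).1 rfl
  have hleg : ∀ k, k₀ ≤ k → Legal p d ⇑(c k).r := fun k hk => tail_ledger_legal p hc hw hr0 hfloor hshade hk
  have hchild : ∀ k, k₀ ≤ k → ⇑(c (k + 1)).r = child p d ⇑(c k).r (j k) (fun i => decide (β k i = 0)) :=
    fun k hk => tail_ledger_child_eff p hc hw hr0 hfloor hshade hk
  -- the edge clauses of the certificate along the walk
  have hedge : ∀ k, k₂ ≤ k → h P ⇑(c (k + 1)).r ≤ h P ⇑(c k).r ∧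
      (v (h P ⇑(c k).r) = 3 → h P ⇑(c (k + 1)).r = h P ⇑(c k).r → ¬ Lossy ⇑(c k).r ⇑(c (k + 1)).r) ∧
      (5 ≤ v (h P ⇑(c k).r) → h P ⇑(c (k + 1)).r = h P ⇑(c k).r →
        hitsWB P ⇑(c k).r (v (h P ⇑(c k).r) - 5) (j k) (fun i => decide (β k i = 0)) = false) ∧
      (v (h P ⇑(c k).r) = 2 → h P ⇑(c (k + 1)).r = h P ⇑(c k).r → ∀ (jj' : Fin 4) (S' : Fin 4 → Bool), keepsB P jj' S' = true →
        Legal p d (child p d ⇑(c (k + 1)).r jj' S') → ok P (child p d ⇑(c (k + 1)).r jj' S') = true →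
        h P (child p d ⇑(c (k + 1)).r jj' S') = h P ⇑(c k).r → jj' ≠ j k → child p d ⇑(c (k + 1)).r jj' S' (j k) = 0) := by
    intro k hk
    obtain ⟨-, hE⟩ := sound_of_ledgerCheckPermAt (H P) _ (hleg k (by omega)) (hokk k hk)
    have h1 := hE (j k) (fun i => decide (β k i = 0)) (hkeeps k (by omega))
      (by rw [← hchild k (by omega)]; exact hleg (k + 1) (by omega)) (by rw [← hchild k (by omega)]; exact hokk (k + 1) (by omega))
    rw [← hchild k (by omega)] at h1
    exact h1
  obtain ⟨k₃, hk₃, hlev⟩ := eventually_constant_of_antitone (f := fun k => h P ⇑(c k).r) (k₀ := k₂) fun k hk => (hedge k hk).1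
  set i := h P ⇑(c k₃).r with hi
  obtain ⟨⟨hvle, -, hHV, hFR⟩, -⟩ := sound_of_ledgerCheckPermAt (H P) _ (hleg k₃ (by omega)) (hokk k₃ hk₃)
  -- the weights of the frozen letters do not move after `k₁`
  have hconstP : ∀ z, P z = true → ∀ m, k₁ ≤ m → (c m).r z = (c k₁).r z := by
    intro z hz m hm
    obtain ⟨t, rfl⟩ := Nat.exists_eq_add_of_le hm
    induction t with
    | zero => rfl
    | succ t ih =>
      rw [← ih (by omega), show k₁ + (t + 1) = k₁ + t + 1 by ring]
      have hc1 := congrFun (hchild (k₁ + t) (by omega)) z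
      rw [child_apply_of_ne_decide _ (Ne.symm (hfrozenβ _ (by omega) z hz).1), if_pos (hfrozenβ _ (by omega) z hz).2] at hc1
      exact hc1
  refine ⟨P, i, k₃, by omega, fun k hk => ⟨hleg k (by omega), hokk k (by omega), hlev k hk⟩,
    fun k hk z hz => hfrozen k (by omega) z hz, hhit, hvle, fun hv1 => ?_, fun hv2 => ?_, fun hv4 => ?_, fun hv5 => ?_,
    fun hv3 k hk => (hedge k (by omega)).2.1 (by rw [hlev k hk]; exact hv3) (by rw [hlev k hk, hlev (k + 1) (by omega)])⟩
  · -- verdict 1: the dock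
    obtain ⟨k, hk, hlow⟩ := exists_lowerBand_after p hc hw hr0 hfloor hshade (k₂ := k₃) (by omega)
    obtain ⟨⟨-, hLB', -, -⟩, -⟩ := sound_of_ledgerCheckPermAt (H P) _ (hleg k (by omega)) (hokk k (by omega))
    exact hLB' (by rw [hlev k hk]; exact hv1) hlow
  · -- verdict 2: FT
    obtain ⟨k, hk, hsat⟩ := exists_satellite_after p hc hw k₃
    obtain ⟨hjj, hne⟩ := (tail_isSatellite_iff p hc hw hr0 hfloor hshade (k := k) (by omega)).mp hsat
    have hS := (hedge k (by omega)).2.2.2 (by rw [hlev k hk]; exact hv2) (by rw [hlev k hk, hlev (k + 1) (by omega)])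
      (j (k + 1)) (fun i => decide (β (k + 1) i = 0)) (hkeeps (k + 1) (by omega))
    rw [← hchild (k + 1) (by omega)] at hS
    exact hne (hS (hleg (k + 2) (by omega)) (hokk (k + 2) (by omega)) (by rw [hlev k hk, hlev (k + 2) (by omega)]) hjj)
  · -- verdict 4: the WEIGHTED frozen letters form a heavy permanent set (res-dim4-p-5's ledger theorem)
    have hW := hHV (by rw [← hi]; exact hv4)
    rw [permWeight_eq_sum] at hW
    -- drop the weightless frozen letters from the sum
    have hW' : p ≤ d + ∑ z ∈ (Finset.univ.filter fun z => P z = true ∧ (c k₃).r z ≠ 0), (c k₃).r z := by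
      rw [show (Finset.univ.filter fun z => P z = true ∧ (c k₃).r z ≠ 0) =
          (Finset.univ.filter fun z => P z = true).filter (fun z => (c k₃).r z ≠ 0) from
        (Finset.filter_filter _ _ _).symm, Finset.sum_filter_ne_zero]
      exact hW
    exact no_tail_of_permanent_weight_ge p hc hw hr0 hfloor hshade (M := k₃) (by omega)
      (P := Finset.univ.filter fun z => P z = true ∧ (c k₃).r z ≠ 0)
      (fun z hz m hm => by
        rw [Finset.mem_filter] at hz
        refine ⟨(hfrozen m (by omega) z hz.2.1).1.symm, ((hfrozen m (by omega) z hz.2.1).2).resolve_right ?_⟩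
        rw [hconstP z hz.2.1 m (by omega), ← hconstP z hz.2.1 k₃ (by omega)]
        exact hz.2.2) hW'
  · -- verdicts 5 + w: a kept-so-far non-frozen letter of weight w is (effectively) hit inside the level
    obtain ⟨z, hPz, hzw⟩ := (hasFreeWB_eq_true_iff P _ _).mp (hFR (by rw [← hi]; exact hv5))
    have hex : ∃ k, k₃ ≤ k ∧ (j k = z ∨ β k z ≠ 0) := by
      obtain ⟨k, hk, hjk⟩ := hhitβ z hPz k₃
      exact ⟨k, hk, hjk⟩
    have hk : k₃ ≤ Nat.find hex ∧ (j (Nat.find hex) = z ∨ β (Nat.find hex) z ≠ 0) := Nat.find_spec hex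
    have hmin : ∀ m, k₃ ≤ m → m < Nat.find hex → j m ≠ z ∧ β m z = 0 := fun m hm hmk => by
      have := Nat.find_min hex hmk
      push Not at this
      exact this hm
    -- the weight of `z` is still `w` at the first hit
    have hconst : ∀ m, k₃ ≤ m → m ≤ Nat.find hex → (c m).r z = (c k₃).r z := by
      intro m hm hmk
      obtain ⟨t, rfl⟩ := Nat.exists_eq_add_of_le hm
      induction t with
      | zero => rfl
      | succ t ih =>
        have hlt : k₃ + t < Nat.find hex := by omega
        rw [← ih (by omega) (by omega), show k₃ + (t + 1) = k₃ + t + 1 by ring]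
        have hc1 := congrFun (hchild (k₃ + t) (by omega)) z
        rw [child_apply_of_ne_decide _ (Ne.symm (hmin _ (by omega) hlt).1), if_pos (hmin _ (by omega) hlt).2] at hc1
        exact hc1
    set k := Nat.find hex
    have hhits := hitsWB_eq_true_of P ⇑(c k).r (v (h P ⇑(c k).r) - 5) (j k) (fun i => decide (β k i = 0)) hPz
      (by rw [hlev k hk.1, hconst k hk.1 le_rfl]; exact hzw) (by
        rcases hk.2 with h | h
        · exact Or.inl h
        · exact Or.inr (by simp [h]))
    rw [(hedge k (by omega)).2.2.1 (by rw [hlev k hk.1]; exact hv5) (by rw [hlev k hk.1, hlev (k + 1) (by omega)])] at hhits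
    exact Bool.false_ne_true hhits

/-! ## 3. The lossy branch and the free letter -/

/-- **LOSSY-BRANCH CONFINEMENT, EFFECTIVE MONITOR** (every prime `p`, every shade `d`, ANY `e_G`): with lossy steps beyond every index, a
certificate `∀ P, ledgerCheckPermAt p d ok h v P = true` (all verdicts) and an `ok` admissible for the effective monitor confine the tail to a
LIVE level at a frozen set of never-charted never-lost letters. [OURS] [cite: CossartJannsenSaito2020, Thm. 3.14] -/
theorem tail_confined_of_ledgerCheckPerm_lossy_eff
    (hc : ∀ k, IsIsolated p (c k).F ∧ Step0 p (c k) (c (k + 1))) (hw : FreeTail.IsWitnessedChain p c j b)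
    (hr0 : ∀ e ∈ (c 0).F.support, (c 0).r ≤ e) (hfloor : ∀ k, ordZero (c k).F ≠ p) {k₀ d : ℕ}
    (hshade : ∀ k, k₀ ≤ k → (c k).shade = (d : ℕ∞)) (hlossy : ∀ k₂, ∃ k, k₂ ≤ k ∧ Lossy ⇑(c k).r ⇑(c (k + 1)).r)
    {ok : (Fin 4 → Bool) → (Fin 4 → ℕ) → Bool} {h : (Fin 4 → Bool) → (Fin 4 → ℕ) → ℕ} {v : ℕ → ℕ}
    (H : ∀ P, ledgerCheckPermAt p d ok h v P = true)
    (hok : ∀ (P : Fin 4 → Bool) (k₁ : ℕ), k₀ ≤ k₁ →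
      (∀ k, k₁ ≤ k → ∀ z, P z = true → j k ≠ z ∧ (b k z = 0 ∨ (c k).r z = 0)) →
      (∀ z, P z = false → ∀ k₂, ∃ k, k₂ ≤ k ∧ (j k = z ∨ (b k z ≠ 0 ∧ (c k).r z ≠ 0))) →
      ∃ k₂, k₁ ≤ k₂ ∧ ∀ k, k₂ ≤ k → ok P ⇑(c k).r = true) :
    ∃ (P : Fin 4 → Bool) (i k₂ : ℕ), v i = 0 ∧ k₀ ≤ k₂ ∧ (∀ k, k₂ ≤ k → Legal p d ⇑(c k).r ∧ ok P ⇑(c k).r = true ∧ h P ⇑(c k).r = i) ∧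
      (∀ k, k₂ ≤ k → ∀ z, P z = true → j k ≠ z ∧ (b k z = 0 ∨ (c k).r z = 0)) ∧
      (∀ z, P z = false → ∀ k₃, ∃ k, k₃ ≤ k ∧ (j k = z ∨ (b k z ≠ 0 ∧ (c k).r z ≠ 0))) := by
  obtain ⟨P, i, k₂, hk₂, hlev, hfrozen, hhit, hvle, h1, h2, h4, h5, h3⟩ :=
    frozen_confinement_core_eff p hc hw hr0 hfloor hshade H hok
  refine ⟨P, i, k₂, ?_, hk₂, hlev, hfrozen, hhit⟩
  have h3' : v i ≠ 3 := fun hv3 => by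
    obtain ⟨k, hk, hl⟩ := hlossy k₂
    exact h3 hv3 k hk hl
  omega

omit [Fact p.Prime] [CharP K p] [DecidableEq K] in
/-- `okAll` is admissible for the effective monitor as well. [OURS · bookkeeping] -/
theorem okAll_admissible_eff (k₀ : ℕ) : ∀ (P : Fin 4 → Bool) (k₁ : ℕ), k₀ ≤ k₁ →
    (∀ k, k₁ ≤ k → ∀ z, P z = true → j k ≠ z ∧ (b k z = 0 ∨ (c k).r z = 0)) →
    (∀ z, P z = false → ∀ k₂, ∃ k, k₂ ≤ k ∧ (j k = z ∨ (b k z ≠ 0 ∧ (c k).r z ≠ 0))) →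
    ∃ k₂, k₁ ≤ k₂ ∧ ∀ k, k₂ ≤ k → okAll P ⇑(c k).r = true :=
  fun _ k₁ _ _ _ => ⟨k₁, le_rfl, fun _ _ => rfl⟩

/-- **A WEIGHTLESS UNCHARTED LETTER IS FROZEN** (every prime `p`, every shade `d`, ANY `e_G`) — the T-sector reading: if some letter `φ` has
weight `0` and is never charted from `k₀` on (res-dim4-p-1's T-sector normal form supplies this for the form-carrying letter) and the tail is lossy
beyond every index, then the tail is confined to a LIVE level of the certificate at a frozen set `P` CONTAINING `φ`; every frozen letter is never
charted nor lost, every other letter is charted or lost beyond every index. [OURS] [cite: CossartJannsenSaito2020, Thm. 3.14] -/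
theorem tail_lossy_confined_freeLetter
    (hc : ∀ k, IsIsolated p (c k).F ∧ Step0 p (c k) (c (k + 1))) (hw : FreeTail.IsWitnessedChain p c j b)
    (hr0 : ∀ e ∈ (c 0).F.support, (c 0).r ≤ e) (hfloor : ∀ k, ordZero (c k).F ≠ p) {k₀ d : ℕ}
    (hshade : ∀ k, k₀ ≤ k → (c k).shade = (d : ℕ∞)) (hlossy : ∀ k₂, ∃ k, k₂ ≤ k ∧ Lossy ⇑(c k).r ⇑(c (k + 1)).r)
    {φ : Fin 4} (hφ : ∀ k, k₀ ≤ k → (c k).r φ = 0 ∧ j k ≠ φ)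
    {h : (Fin 4 → Bool) → (Fin 4 → ℕ) → ℕ} {v : ℕ → ℕ} (H : ∀ P, ledgerCheckPermAt p d okAll h v P = true) :
    ∃ (P : Fin 4 → Bool) (i k₂ : ℕ), v i = 0 ∧ k₀ ≤ k₂ ∧ P φ = true ∧
      (∀ k, k₂ ≤ k → Legal p d ⇑(c k).r ∧ h P ⇑(c k).r = i ∧ (c k).r φ = 0) ∧
      (∀ k, k₂ ≤ k → ∀ z, P z = true → j k ≠ z ∧ (b k z = 0 ∨ (c k).r z = 0)) ∧
      (∀ z, P z = false → ∀ k₃, ∃ k, k₃ ≤ k ∧ (j k = z ∨ (b k z ≠ 0 ∧ (c k).r z ≠ 0))) := by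
  obtain ⟨P, i, k₂, hv, hk₂, hlev, hfrozen, hhit⟩ :=
    tail_confined_of_ledgerCheckPerm_lossy_eff p hc hw hr0 hfloor hshade hlossy H (okAll_admissible_eff (c := c) (j := j) (b := b) k₀)
  have hPφ : P φ = true := by
    by_contra hne
    rw [Bool.not_eq_true] at hne
    obtain ⟨k, hk, hjk⟩ := hhit φ hne k₂
    rcases hjk with hjk | ⟨-, hr⟩
    · exact (hφ k (by omega)).2 hjk
    · exact hr (hφ k (by omega)).1
  exact ⟨P, i, k₂, hv, hk₂, hPφ, fun k hk => ⟨(hlev k hk).1, (hlev k hk).2.2, (hφ k (by omega)).1⟩, hfrozen, hhit⟩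

end Chain

end ResCone

end Summit.ResolutionOfSingularities.ResolutionOfSingularities.Theorems.PIDim4

end
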